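import Summits.QuantumFields.QCD.Theorems.WilsonMobilityGapMobilityGapPinchDiagonalExit

/-!
# Crux `MobilityGap` (stmt-QuantumFields-9150), line `Ideator6Sketch` — the abstract index is circular
# (lead a1's certificate on stubs S1b/S2 of the integer pinch)

The card `integer-pinch-unitary-point` locates the unitary point by "an integer that must jump": a
disorder-averaged second Chern number `ch` of the Fermi projection of `Γ₅ D_W(m₀)`, locally constant wherever
a fractional-moment bound persists, with `ch = -3` in the doubler pocket and `ch = 0` on the trivial plateau.
The tree has no such object, so the wave-1 fragments could only take `ch : ℝ → ℤ` as a PARAMETER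
(`unitaryPoint_of_locallyConstantIndex`, p128922; `valencePinch_of_plateauIndex`, p129255).  This file
records, kernel-checked, why that is not a decomposition: for ANY predicate `P` ("localised at its own sea
mass"), the existence of an abstract integer assignment that is locally constant on `P` and separates the
two ends of `[-1, 1]` is IMPLIED BY the conclusion it is meant to prove (an exit point `x ∈ (-1, 0]` with
`¬ P x`) — `locallyConstantIndex_of_exit` — and hence, under the standing deterministic inputs (openness of
`P`, pocket corner, trivial plateau), EQUIVALENT to it (`locallyConstantIndex_iff_exit`).  Consequently an
index-typed stub for S1b/S2 carries content only through a DEFINED invariant whose end values are computed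
independently and whose constancy along mobility intervals is a theorem (Aizenman–Graf 1998;
Prodan–Schulz-Baldes 2016, Ch. 5–6) — a Literature-level definition programme, not a stub of this line.
Pure topology/logic; no physics.
-/

noncomputable section

namespace Summit.QuantumFields.QCD.Theorems.MobilityGapPinch

open scoped Topology
open Filter Set

/-- **An exit point manufactures an abstract index.**  If some `x₀ ∈ (-1, 0]` is not localised, then the
step function `ch = 𝟙[x₀, ∞)` is an integer assignment with `ch(-1) ≠ ch(1)` that is locally constant at
every localised mass (indeed at every mass `≠ x₀`).  So "there is a locally constant integer index
separating the ends" is no stronger than the unitary point itself. -/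
theorem locallyConstantIndex_of_exit : ∀ (P : ℝ → Prop),
    (∃ x : ℝ, -1 < x ∧ x ≤ 0 ∧ ¬ P x) →
    ∃ ch : ℝ → ℤ, ch (-1) ≠ ch 1 ∧ ∀ x : ℝ, P x → ∀ᶠ t in nhds x, ch t = ch x := by
  rintro P ⟨x₀, hx₀, hx₀', hP⟩
  refine ⟨fun t => if t < x₀ then 0 else 1, ?_, ?_⟩
  · have h1 : ¬ (1 : ℝ) < x₀ := by linarith
    simp [hx₀, h1]
  · intro x hx
    have hne : x ≠ x₀ := fun h => hP (h ▸ hx)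
    rcases lt_or_gt_of_ne hne with hlt | hgt
    · filter_upwards [Iio_mem_nhds hlt] with t ht
      rw [if_pos (mem_Iio.1 ht), if_pos hlt]
    · filter_upwards [Ioi_mem_nhds hgt] with t ht
      rw [if_neg (not_lt.2 (le_of_lt (mem_Ioi.1 ht))), if_neg (not_lt.2 hgt.le)]

/-- **The abstract index is equivalent to the exit point** under the deterministic inputs of
`unitaryPoint_of_locallyConstantIndex` (localisation open in the bare mass — the part of "the bet" that is
index-free — the pocket corner `P(-1)`, and the trivial plateau `P x` for `0 < x ≤ 1`): the existence of an
integer assignment, locally constant on the localised set and different at the two ends, holds iff some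
`x ∈ (-1, 0]` is not localised.  Hence feeding S2 an ∃-quantified index is circular; only a DEFINED index
with computed end values breaks the circle. -/
theorem locallyConstantIndex_iff_exit (P : ℝ → Prop)
    (hopen : ∀ x : ℝ, -1 ≤ x → x ≤ 1 → P x → ∀ᶠ t in nhds x, P t)
    (hpocket : P (-1)) (htriv : ∀ x : ℝ, 0 < x → x ≤ 1 → P x) :
    (∃ ch : ℝ → ℤ, ch (-1) ≠ ch 1 ∧ ∀ x : ℝ, -1 ≤ x → x ≤ 1 → P x → ∀ᶠ t in nhds x, ch t = ch x) ↔
      ∃ x : ℝ, -1 < x ∧ x ≤ 0 ∧ ¬ P x := by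
  constructor
  · rintro ⟨ch, hjump, hconst⟩
    exact unitaryPoint_of_locallyConstantIndex P ch
      (fun x h1 h2 hx => (hopen x h1 h2 hx).and (hconst x h1 h2 hx)) hpocket hjump htriv
  · intro h
    obtain ⟨ch, hjump, hconst⟩ := locallyConstantIndex_of_exit P h
    exact ⟨ch, hjump, fun x _ _ hx => hconst x hx⟩

end Summit.QuantumFields.QCD.Theorems.MobilityGapPinch

end
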